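import Literature.NumberTheory.Automorphic.RestrictedProductBoxHecke
import HarnessLib

/-!
# Hecke operators of a box subgroup act by the product of the local scalars (restricted products, no commutativity assumed)

Topic `NumberTheory/Automorphic`; namespace `Literature.NumberTheory.Automorphic`.  THEOREMS ONLY, sequel of
`RestrictedProductBoxHecke` (centraliser translation, one place, product of transversals).

Let `Γ = Πʳ i, [G i, K i]`, `C = ∏ L_i` a box subgroup (`boxSubgroup L`), `S` a set of places, and `π : Γ → GL(W)` a representation
such that at every place `i ∉ S` the local Hecke operators `[L_i a L_i]` (finite double cosets) act on the `L_i`-fixed vectors of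
`π ∘ ι_i` by scalars `c i a` (e.g. `π|_{G_i}` isotypic of a type with a spherical LINE, ★ `IsotypicHeckeScalar`).
* `exists_transversal_boxSubgroup` — for `γ` with `γ_j ∈ L_j` off a finite `T ⊆ Sᶜ`, `C γ C / C` has a finite transversal
  supported on `T`; `heckeOperator_boxSubgroup_apply_eq_prod_smul` — on `W^C`, `[CγC] w = (∏_{i ∈ T} c i (γ_i)) • w` (both by
  induction on `T` over the two-place product of transversals).
* `finite_orbit_boxSubgroup`, `heckeOperator_boxSubgroup_apply_eq_smul` — if the places `j ∈ S` carry TRIVIAL sides `L_j = ⊥`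
  (so `C = K^S`-type boxes) then for EVERY `γ`, with `g₀` its `S`-part (`g₀_j = γ_j` on `S`, `1` off `S`; `g₀` centralises `C`):
  `C γ C / C` is finite and `[CγC] w = (∏_{i ∈ T} c i (γ_i)) • π(g₀) w` on `W^C`.
This is the operator form of Flath's `ℋ(G, K^S K'_S) ≅ ℋ(G_S, K'_S) ⊗ ⊗'_{v ∉ S} ℋ(G_v, K_v)` (Flath 1979, Thm. 2 and §2 Example 2;
Bump 1997, Thm. 3.4.4, pp. 314–315) with the unramified factors acting through their scalars; no Gelfand-pair hypothesis.

## References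
* D. Flath, *Decomposition of representations into tensor products*, PSPM 33.1 (1979), §2 Example 2, Thm. 2.
* D. Bump, *Automorphic Forms and Representations* (1997), §3.4, Thm. 3.4.4; Prop. 4.2.3.
-/

set_option autoImplicit false

noncomputable section

open MulAction
open scoped RestrictedProduct

namespace Literature.NumberTheory.Automorphic

universe u v uk w

variable {ι : Type u} {G : ι → Type v} [∀ i, Group (G i)] {K : ∀ i, Subgroup (G i)} [DecidableEq ι]
variable {k : Type uk} [CommRing k]
variable (L : ∀ i, Subgroup (G i)) (S : Set ι) (c : ∀ i, G i → k)

/-- **Transversal of `C γ C / C` supported on the bad places.**  Let `C = ∏ L_i` and `T` a finite set of places outside `S`,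
with `L_i a L_i / L_i` finite for `i ∉ S`.  Every `γ` with `γ_j ∈ L_j` at all `j ∉ T` has a finite transversal of `C γ C / C` whose
members have trivial coordinates off `T` (Flath 1979, §2 Example 2: the double cosets of a box multiply coordinatewise).
[cite: FlathCorvallis1979, §2 Example 2] -/
theorem exists_transversal_boxSubgroup [DecidableEq (Πʳ i, [G i, K i])]
    (hfin : ∀ i, i ∉ S → ∀ a : G i, (orbit (L i) (a : G i ⧸ L i)).Finite)
    (T : Finset ι) (hTS : ∀ i ∈ T, i ∉ S) :
    ∀ γ : Πʳ i, [G i, K i], (∀ j, j ∉ T → γ j ∈ L j) →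
      ∃ s : Finset (Πʳ i, [G i, K i]),
        Set.BijOn (fun x : Πʳ i, [G i, K i] => (x : (Πʳ i, [G i, K i]) ⧸ boxSubgroup (K := K) L)) s
          (orbit (boxSubgroup (K := K) L) (γ : (Πʳ i, [G i, K i]) ⧸ boxSubgroup (K := K) L)) ∧
        ∀ x ∈ s, ∀ j, j ∉ T → x j = 1 := by
  classical
  induction T using Finset.induction_on with
  | empty =>
    intro γ hγ
    have hγC : γ ∈ boxSubgroup (K := K) L := fun j => hγ j (by simp)
    have hmk : ((γ : Πʳ i, [G i, K i]) : (Πʳ i, [G i, K i]) ⧸ boxSubgroup (K := K) L) =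
        ((1 : Πʳ i, [G i, K i]) : (Πʳ i, [G i, K i]) ⧸ boxSubgroup (K := K) L) := by
      rw [QuotientGroup.eq, mul_one]
      exact (boxSubgroup L).inv_mem hγC
    refine ⟨{1}, ⟨?_, by simp [Set.InjOn], ?_⟩, fun x hx j _ => by simp [Finset.mem_singleton.1 hx]⟩
    · intro x hx
      rw [Finset.coe_singleton, Set.mem_singleton_iff] at hx
      subst hx
      rw [hmk]
      exact mem_orbit_self _
    · intro z hz
      obtain ⟨d, rfl⟩ := mem_orbit_iff.1 hz
      refine ⟨1, by simp, ?_⟩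
      change ((1 : Πʳ i, [G i, K i]) : (Πʳ i, [G i, K i]) ⧸ boxSubgroup (K := K) L) =
        (((d : Πʳ i, [G i, K i]) * γ : Πʳ i, [G i, K i]) : _)
      rw [QuotientGroup.eq, inv_one, one_mul]
      exact (boxSubgroup L).mul_mem d.2 hγC
  | insert i T' hi IH =>
    intro γ hγ
    have hiS : i ∉ S := hTS i (Finset.mem_insert_self i T')
    have hT'S : ∀ j ∈ T', j ∉ S := fun j hj => hTS j (Finset.mem_insert_of_mem hj)
    -- split `γ = ι_i(γ_i) β` with `β_i = 1`
    have hβi : ((RestrictedProduct.mulSingle K i (γ i))⁻¹ * γ) i = 1 := by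
      simp [RestrictedProduct.mul_apply, RestrictedProduct.inv_apply]
    have hβj : ∀ j, j ≠ i → ((RestrictedProduct.mulSingle K i (γ i))⁻¹ * γ) j = γ j := fun j hj => by
      simp [RestrictedProduct.mul_apply, RestrictedProduct.inv_apply, Pi.mulSingle_eq_of_ne hj]
    have hβT' : ∀ j, j ∉ T' → ((RestrictedProduct.mulSingle K i (γ i))⁻¹ * γ) j ∈ L j := fun j hj => by
      by_cases hji : j = i
      · subst hji; rw [hβi]; exact (L j).one_mem
      · rw [hβj j hji]; exact hγ j (by simp [hji, hj])
    obtain ⟨s₂, hs₂, hs₂supp⟩ := IH hT'S _ hβT'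
    have hs₂i : ∀ y ∈ s₂, y i = 1 := fun y hy => hs₂supp y hy i hi
    obtain ⟨s₁, hs₁⟩ := exists_transversal_of_finite_orbit (L i) (hfin i hiS (γ i))
    obtain ⟨-, hbij⟩ := bijOn_image_mul_orbit_boxSubgroup L i (γ i) _ γ hβi (mul_inv_cancel_left _ _) hs₁ hs₂i hs₂
    refine ⟨_, hbij, ?_⟩
    intro x hx j hj
    obtain ⟨⟨x₁, y⟩, hxy, rfl⟩ := Finset.mem_image.1 hx
    obtain ⟨-, hy⟩ := Finset.mem_product.1 hxy
    have hji : j ≠ i := by rintro rfl; exact hj (Finset.mem_insert_self j T')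
    have hjT' : j ∉ T' := fun h => hj (Finset.mem_insert_of_mem h)
    simp [RestrictedProduct.mul_apply, Pi.mulSingle_eq_of_ne hji, hs₂supp y hy j hjT']

/-- **The product of the local scalars.**  Let `C = ∏ L_i`, `T` a finite set of places outside `S`, and `π` a representation
whose local Hecke operators at the places of `T` act on the `L_i`-fixed vectors of `π ∘ ι_i` by the scalars `c i a`.  Then for
every `γ` with `γ_j ∈ L_j` at all `j ∉ T` and every `w ∈ W^C`: `[CγC] w = (∏_{i ∈ T} c i (γ_i)) • w`. (Flath 1979, Thm. 2 ∕ §2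
Example 2, read on operators: `[C ι_i(a)β C] = [L_i a L_i] ∘ [CβC]` for `β_i = 1`.) [cite: FlathCorvallis1979, Thm. 2] -/
theorem heckeOperator_boxSubgroup_apply_eq_prod_smul
    (hfin : ∀ i, i ∉ S → ∀ a : G i, (orbit (L i) (a : G i ⧸ L i)).Finite)
    {W : Type w} [AddCommGroup W] [Module k W] (π : Representation k (Πʳ i, [G i, K i]) W)
    (T : Finset ι) (hTS : ∀ i ∈ T, i ∉ S)
    (hc : ∀ i ∈ T, ∀ a : G i, ∀ w ∈ Representation.fixedPoints (π.comp (mulSingleHom K i)) (L i),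
      heckeOperator (π.comp (mulSingleHom K i)) (L i) a w = c i a • w) :
    ∀ γ : Πʳ i, [G i, K i], (∀ j, j ∉ T → γ j ∈ L j) →
      ∀ w ∈ π.fixedPoints (boxSubgroup (K := K) L),
        heckeOperator π (boxSubgroup (K := K) L) γ w = (∏ i ∈ T, c i (γ i)) • w := by
  classical
  induction T using Finset.induction_on with
  | empty =>
    intro γ hγ w hw
    have hγC : γ ∈ boxSubgroup (K := K) L := fun j => hγ j (by simp)
    have hmk : ((γ : Πʳ i, [G i, K i]) : (Πʳ i, [G i, K i]) ⧸ boxSubgroup (K := K) L) =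
        ((1 : Πʳ i, [G i, K i]) : (Πʳ i, [G i, K i]) ⧸ boxSubgroup (K := K) L) := by
      rw [QuotientGroup.eq, mul_one]
      exact (boxSubgroup L).inv_mem hγC
    rw [Finset.prod_empty, one_smul, heckeOperator, hmk, ← heckeOperator, heckeOperator_one_apply _ _ hw]
  | insert i T' hi IH =>
    intro γ hγ w hw
    have hiS : i ∉ S := hTS i (Finset.mem_insert_self i T')
    have hT'S : ∀ j ∈ T', j ∉ S := fun j hj => hTS j (Finset.mem_insert_of_mem hj)
    have hβi : ((RestrictedProduct.mulSingle K i (γ i))⁻¹ * γ) i = 1 := by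
      simp [RestrictedProduct.mul_apply, RestrictedProduct.inv_apply]
    have hβj : ∀ j, j ≠ i → ((RestrictedProduct.mulSingle K i (γ i))⁻¹ * γ) j = γ j := fun j hj => by
      simp [RestrictedProduct.mul_apply, RestrictedProduct.inv_apply, Pi.mulSingle_eq_of_ne hj]
    have hβT' : ∀ j, j ∉ T' → ((RestrictedProduct.mulSingle K i (γ i))⁻¹ * γ) j ∈ L j := fun j hj => by
      by_cases hji : j = i
      · subst hji; rw [hβi]; exact (L j).one_mem
      · rw [hβj j hji]; exact hγ j (by simp [hji, hj])
    -- transversals: `s₂` for `β` (supported on `T'`), `s₁` for `γ_i` at the place `i`, and their product for `γ`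
    obtain ⟨s₂, hs₂, hs₂supp⟩ := exists_transversal_boxSubgroup L S hfin T' hT'S _ hβT'
    have hs₂i : ∀ y ∈ s₂, y i = 1 := fun y hy => hs₂supp y hy i hi
    obtain ⟨s₁, hs₁⟩ := exists_transversal_of_finite_orbit (L i) (hfin i hiS (γ i))
    obtain ⟨hinj, hbij⟩ := bijOn_image_mul_orbit_boxSubgroup L i (γ i) _ γ hβi (mul_inv_cancel_left _ _) hs₁ hs₂i hs₂
    have hw₁ : w ∈ Representation.fixedPoints (π.comp (mulSingleHom K i)) (L i) := by
      rw [Representation.mem_fixedPoints]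
      intro l hl
      exact (π.mem_fixedPoints _ w).1 hw _ (mulSingle_mem_boxSubgroup_iff.2 hl)
    have hIH := IH hT'S (fun j hj => hc j (Finset.mem_insert_of_mem hj)) _ hβT' w hw
    rw [heckeOperator_apply_eq_sum _ _ _ _ hs₂ hw] at hIH
    rw [heckeOperator_apply_eq_sum _ _ _ _ hbij hw, Finset.sum_image hinj, Finset.sum_product]
    simp_rw [map_mul, Module.End.mul_apply]
    have hinner : ∀ x₁ ∈ s₁, ∑ y ∈ s₂, π (RestrictedProduct.mulSingle K i x₁) (π y w) =
        (∏ j ∈ T', c j (((RestrictedProduct.mulSingle K i (γ i))⁻¹ * γ) j)) • π (RestrictedProduct.mulSingle K i x₁) w :=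
      fun x₁ _ => by rw [← map_sum, hIH, map_smul]
    rw [Finset.sum_congr rfl hinner, ← Finset.smul_sum]
    have hloc : ∑ x₁ ∈ s₁, π (RestrictedProduct.mulSingle K i x₁) w = heckeOperator (π.comp (mulSingleHom K i)) (L i) (γ i) w := by
      rw [heckeOperator_apply_eq_sum _ _ _ _ hs₁ hw₁]
      rfl
    rw [hloc, hc i (Finset.mem_insert_self i T') (γ i) w hw₁, smul_smul, Finset.prod_insert hi,
      Finset.prod_congr rfl fun j hj => by rw [hβj j (ne_of_mem_of_not_mem hj hi)], mul_comm]

/-- **Finiteness of `C γ C / C` for the box `C = K^S`-type box** (`L_j = ⊥` at the places of `S`): the Hecke-pair condition for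
the compact, non-open subgroup `∏_{j ∉ S} K_j`, from the local ones. [cite: FlathCorvallis1979, §2 Example 2] -/
theorem finite_orbit_boxSubgroup (hLS : ∀ j ∈ S, L j = ⊥)
    (hfin : ∀ i, i ∉ S → ∀ a : G i, (orbit (L i) (a : G i ⧸ L i)).Finite)
    (γ g₀ : Πʳ i, [G i, K i]) (hg₀S : ∀ j ∈ S, g₀ j = γ j) (hg₀ : ∀ j, j ∉ S → g₀ j = 1)
    (T : Finset ι) (hTS : ∀ i ∈ T, i ∉ S) (hγT : ∀ i, i ∉ T → i ∉ S → γ i ∈ L i) :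
    (orbit (boxSubgroup (K := K) L) (γ : (Πʳ i, [G i, K i]) ⧸ boxSubgroup (K := K) L)).Finite := by
  classical
  -- `γ = g₀ γ°` with `g₀` centralising `C` and `γ°` supported (mod `L`) on `T`
  have hcent : ∀ d ∈ boxSubgroup (K := K) L, g₀ * d = d * g₀ := fun d hd => by
    refine DFunLike.ext _ _ fun j => ?_
    rw [RestrictedProduct.mul_apply, RestrictedProduct.mul_apply]
    by_cases hj : j ∈ S
    · have : d j = 1 := by simpa [hLS j hj] using hd j
      rw [this, mul_one, one_mul]
    · rw [hg₀ j hj, mul_one, one_mul]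
  have hγ' : ∀ j, j ∉ T → (g₀⁻¹ * γ) j ∈ L j := fun j hj => by
    rw [RestrictedProduct.mul_apply, RestrictedProduct.inv_apply]
    by_cases hjS : j ∈ S
    · rw [hg₀S j hjS, inv_mul_cancel]; exact (L j).one_mem
    · rw [hg₀ j hjS, inv_one, one_mul]; exact hγT j hj hjS
  obtain ⟨s, hs, -⟩ := exists_transversal_boxSubgroup L S hfin T hTS (g₀⁻¹ * γ) hγ'
  have h := finite_orbit_mul_left_of_centralizer (boxSubgroup (K := K) L) hcent (γ := g₀⁻¹ * γ)
    (by rw [← hs.image_eq]; exact (Finset.finite_toSet _).image _)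
  rwa [mul_inv_cancel_left] at h

/-- **`[CγC]` on `W^C` is the product of the local scalars times the `S`-part of `γ`.**  Let `C = ∏ L_i` with TRIVIAL sides at the
places of `S`, `π` a representation whose local Hecke operators off `S` act by the scalars `c i a` on the `L_i`-fixed vectors of
`π ∘ ι_i`, `γ ∈ Γ`, `g₀` its `S`-part and `T ⊆ Sᶜ` a finite set off which `γ_i ∈ L_i`.  Then for `w ∈ W^C`:
`[CγC] w = (∏_{i ∈ T} c i (γ_i)) • π(g₀) w`. (Flath 1979, Thm. 2: `ℋ(G, C) ≅ ℋ(G_S) ⊗ ⊗'_{v∉S} ℋ(G_v, K_v)`, the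
unramified factors acting through their scalars; Bump 1997, Thm. 3.4.4.) [cite: FlathCorvallis1979, Thm. 2] -/
theorem heckeOperator_boxSubgroup_apply_eq_smul (hLS : ∀ j ∈ S, L j = ⊥)
    {W : Type w} [AddCommGroup W] [Module k W] (π : Representation k (Πʳ i, [G i, K i]) W)
    (hc : ∀ i, i ∉ S → ∀ a : G i, ∀ w ∈ Representation.fixedPoints (π.comp (mulSingleHom K i)) (L i),
      heckeOperator (π.comp (mulSingleHom K i)) (L i) a w = c i a • w)
    (hfin : ∀ i, i ∉ S → ∀ a : G i, (orbit (L i) (a : G i ⧸ L i)).Finite)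
    (γ g₀ : Πʳ i, [G i, K i]) (hg₀S : ∀ j ∈ S, g₀ j = γ j) (hg₀ : ∀ j, j ∉ S → g₀ j = 1)
    (T : Finset ι) (hTS : ∀ i ∈ T, i ∉ S) (hγT : ∀ i, i ∉ T → i ∉ S → γ i ∈ L i)
    {w : W} (hw : w ∈ π.fixedPoints (boxSubgroup (K := K) L)) :
    heckeOperator π (boxSubgroup (K := K) L) γ w = (∏ i ∈ T, c i (γ i)) • π g₀ w := by
  classical
  have hcent : ∀ d ∈ boxSubgroup (K := K) L, g₀ * d = d * g₀ := fun d hd => by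
    refine DFunLike.ext _ _ fun j => ?_
    rw [RestrictedProduct.mul_apply, RestrictedProduct.mul_apply]
    by_cases hj : j ∈ S
    · have : d j = 1 := by simpa [hLS j hj] using hd j
      rw [this, mul_one, one_mul]
    · rw [hg₀ j hj, mul_one, one_mul]
  have hγ' : ∀ j, j ∉ T → (g₀⁻¹ * γ) j ∈ L j := fun j hj => by
    rw [RestrictedProduct.mul_apply, RestrictedProduct.inv_apply]
    by_cases hjS : j ∈ S
    · rw [hg₀S j hjS, inv_mul_cancel]; exact (L j).one_mem
    · rw [hg₀ j hjS, inv_one, one_mul]; exact hγT j hj hjS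
  obtain ⟨s, hs, -⟩ := exists_transversal_boxSubgroup L S hfin T hTS (g₀⁻¹ * γ) hγ'
  have hfin' : (orbit (boxSubgroup (K := K) L) ((g₀⁻¹ * γ : Πʳ i, [G i, K i]) : _ ⧸ boxSubgroup (K := K) L)).Finite := by
    rw [← hs.image_eq]; exact (Finset.finite_toSet _).image _
  have h1 := heckeOperator_apply_mul_of_centralizer π (boxSubgroup (K := K) L) hcent (g₀⁻¹ * γ) hfin' hw
  rw [mul_inv_cancel_left] at h1
  rw [h1, heckeOperator_boxSubgroup_apply_eq_prod_smul L S c hfin π T hTS (fun i hi => hc i (hTS i hi)) _ hγ' w hw,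
    map_smul]
  refine congrArg (· • π g₀ w) (Finset.prod_congr rfl fun i hi => ?_)
  rw [RestrictedProduct.mul_apply, RestrictedProduct.inv_apply, hg₀ i (hTS i hi), inv_one, one_mul]

end Literature.NumberTheory.Automorphic

end
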